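import Summits.NavierStokesRegularity.NavierStokesRegularity.Theorems.StrainDoorsNearFieldDefs
import Summits.NavierStokesRegularity.NavierStokesRegularity.Theorems.StrainClockBudgetedClosers
import Summits.NavierStokesRegularity.NavierStokesRegularity.Theorems.StrainClockDoorsClosers
import Literature.Analysis.FluidPDE.ConstantinDirectionDissipationCalculus
import HarnessLib

/-!
# Near-field parity doors D7 / D7♭ — CLOSERS (nsreg-p1 g33 ROUND-43/44; texts of record r43/Sketch47.lean v4)

`nearFieldParityDoor_of : PressureHessianSplits → FarFieldBudget → BudgetedParityDoor → NearFieldParityDoor`,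
`nearFieldParityDoor_of_plates` (D5 by name), `nearFieldSubParityDoor_of … → StrainRatioDoor → NearFieldSubParityDoor`,
`nearFieldSubParityDoor_of_plates` (A0 by name); kernel bounds `|K_e(y)| ≤ 2/‖y‖³`, `|f| ≤ |∇u|²_F`; plate ledger
Π ← A1, F ← A2 ∧ A3, Π♭ ← A1♭, F♭ ← A2♭ ∧ A3′, the end-to-end `…_of_atoms` closers, and ATOM A2 PROVED
(`farFieldL1Bound_holds`), so `nearFieldParityDoor_of_A1_A3 : NewtonHessianFormula → DissipationPrimitive → NearFieldParityDoor`.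
HONEST FRAME: conditional doors; the remaining atoms are TRUE analysis facts still to be landed by the S-lane. -/

noncomputable section

open MeasureTheory Set Function Filter Metric Real InnerProductSpace
open _root_.Topology
open scoped ENNReal NNReal RealInnerProductSpace ContDiff Laplacian Interval
open Literature.Analysis Literature.Analysis.FluidPDE
open Literature.Analysis.FluidPDE.VorticityDirectionDynamics

set_option linter.dupNamespace false

namespace Summit.NavierStokesRegularity.NavierStokesRegularity.Theorems.StrainDoors

/-- ★ **D7 from the plates and D5**: `PressureHessianSplits → FarFieldBudget → BudgetedParityDoor → NearFieldParityDoor`.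
The arithmetic: `strainFeed = N_r + (1/4π)far ≤ q² + b(t) ≤ q² + (b(t)/l₀)·q` at charged maximisers (`q > l₀ > 0`), with the
rescaled budget `Φ/l₀ ≤ β/l₀`. -/
theorem nearFieldParityDoor_of (hSp : PressureHessianSplits) (hF : FarFieldBudget) (hD5 : BudgetedParityDoor) :
    NearFieldParityDoor := by
  intro ν T t₀ l₀ δ r hν ht₀ hT hl₀ hδ hδ1 hr u p hsol hSob hnear
  obtain ⟨β, Φ, b, hΦ0, hΦ, hfar⟩ := hF ν T t₀ r u p hν ht₀ hT hr hsol hSob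
  refine hD5 ν T t₀ l₀ δ (β / l₀) (fun t => Φ t / l₀) (fun t => b t / l₀) hν ht₀ hT hl₀.le hδ hδ1
    (by simp [hΦ0]) ?_ u p hsol hSob ?_
  · intro t ht
    obtain ⟨h0, hβ, hd⟩ := hΦ t ht
    exact ⟨div_nonneg h0 hl₀.le, div_le_div_of_nonneg_right hβ hl₀.le, hd.div_const l₀⟩
  · intro t ht x e hax hq
    have he : ‖e‖ = 1 := hax.1
    have ht' : t ∈ Ico 0 T := ⟨ht₀.trans ht.1, ht.2⟩
    have hsplit := hSp ν T u p hν hsol hSob t ht' r hr x e he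
    have hfb := hfar t ht x e he
    have hn := hnear t ht x e hax hq
    have hpi : 0 < 1 / (4 * π) := by positivity
    have h1 : (1 / (4 * π)) * farQuad r u t x e ≤ b t :=
      le_trans (mul_le_mul_of_nonneg_left (le_abs_self _) hpi.le) hfb
    have hb0 : 0 ≤ b t := le_trans (mul_nonneg hpi.le (abs_nonneg _)) hfb
    have h2 : b t ≤ b t / l₀ * strainQuad u t x e := by
      rw [div_mul_eq_mul_div, le_div_iff₀ hl₀]
      exact mul_le_mul_of_nonneg_left hq.le hb0
    rw [hsplit]
    linarith

/-- ★ **D7 CLOSED modulo the two TRUE plates**: door D5 is held BY NAME (`budgetedParityDoor_holds`, S41 P0-41 Closers). -/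
theorem nearFieldParityDoor_of_plates (hSp : PressureHessianSplits) (hF : FarFieldBudget) : NearFieldParityDoor :=
  nearFieldParityDoor_of hSp hF budgetedParityDoor_holds

/-- `|K_e(y)| ≤ 2/|y|³` for a unit `e` (Cauchy–Schwarz: `0 ≤ ⟪y,e⟫² ≤ |y|²`). -/
theorem abs_quadKernel_le {e y : EuclideanSpace ℝ (Fin 3)} (he : ‖e‖ = 1) (hy : y ≠ 0) :
    |quadKernel e y| ≤ 2 / ‖y‖ ^ 3 := by
  have hy' : 0 < ‖y‖ := norm_pos_iff.mpr hy
  have hcs : ⟪y, e⟫ ^ 2 ≤ ‖y‖ ^ 2 := by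
    have h := abs_real_inner_le_norm y e
    rw [he, mul_one] at h
    have h' : |⟪y, e⟫| ^ 2 ≤ ‖y‖ ^ 2 := pow_le_pow_left₀ (abs_nonneg _) h 2
    simpa [sq_abs] using h'
  unfold quadKernel
  rw [abs_div, abs_of_pos (by positivity : (0:ℝ) < ‖y‖ ^ 5), div_le_div_iff₀ (by positivity) (by positivity)]
  have h3 : |3 * ⟪y, e⟫ ^ 2 - ‖y‖ ^ 2| ≤ 2 * ‖y‖ ^ 2 := by
    rw [abs_le]; constructor <;> nlinarith [sq_nonneg ⟪y, e⟫]
  calc |3 * ⟪y, e⟫ ^ 2 - ‖y‖ ^ 2| * ‖y‖ ^ 3 ≤ 2 * ‖y‖ ^ 2 * ‖y‖ ^ 3 :=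
        mul_le_mul_of_nonneg_right h3 (by positivity)
    _ = 2 * ‖y‖ ^ 5 := by ring

/-- the far kernel bound: `|y| ≥ r > 0 ⇒ |K_e(y)| ≤ 2/r³`. -/
theorem abs_quadKernel_le_of_le {e y : EuclideanSpace ℝ (Fin 3)} {r : ℝ} (he : ‖e‖ = 1) (hr : 0 < r) (hy : r ≤ ‖y‖) :
    |quadKernel e y| ≤ 2 / r ^ 3 := by
  have hy0 : y ≠ 0 := by
    intro h; rw [h, norm_zero] at hy; linarith
  refine (abs_quadKernel_le he hy0).trans ?_
  gcongr

/-- the local algebra behind plate Π: IF `p_ee = Π_ee + f/3` (i.e. `Δp = f`, `devPressureHess_eq`) THEN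
`strainFeed = localFeed − Π_ee`. -/
theorem strainFeed_eq_localFeed_sub {u : ℝ → (EuclideanSpace ℝ (Fin 3)) → (EuclideanSpace ℝ (Fin 3))}
    {p : ℝ → (EuclideanSpace ℝ (Fin 3)) → ℝ} {t : ℝ} {x e : EuclideanSpace ℝ (Fin 3)} {D : ℝ}
    (hp : pressureHess p t x e = D + qDensity u t x / 3) :
    strainFeed u p t x e = localFeed u t x e - D := by
  unfold strainFeed localFeed; unfold qDensity at hp
  rw [hp]; ring

/-- the cutoff is `1` on `‖y‖ ≤ r`. -/
theorem radialCutoff_of_le {r : ℝ} {y : EuclideanSpace ℝ (Fin 3)} (hr : 0 < r) (hy : ‖y‖ ≤ r) : radialCutoff r y = 1 := by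
  unfold radialCutoff
  apply Real.smoothTransition.one_of_one_le
  have : ‖y‖ / r ≤ 1 := (div_le_one hr).mpr hy
  linarith

/-- the cutoff is `0` on `2r ≤ ‖y‖`. -/
theorem radialCutoff_of_ge {r : ℝ} {y : EuclideanSpace ℝ (Fin 3)} (hr : 0 < r) (hy : 2 * r ≤ ‖y‖) : radialCutoff r y = 0 := by
  unfold radialCutoff
  apply Real.smoothTransition.zero_of_nonpos
  have : 2 ≤ ‖y‖ / r := (le_div_iff₀ hr).mpr hy
  linarith

/-- ★ **D7♭ from the plates and A0**: `PressureHessianSplitsSmooth → FarFieldUniformBound → StrainRatioDoor → NearFieldSubParityDoor`,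
with `c′ = (1+c)/2` and the explicit level `l₁ = max(l₀, √(B/(c′−c)))`. -/
theorem nearFieldSubParityDoor_of (hSp : PressureHessianSplitsSmooth) (hF : FarFieldUniformBound) (hA0 : StrainRatioDoor) :
    NearFieldSubParityDoor := by
  intro ν T t₀ l₀ c δ r hν ht₀ hT hl₀ hc hδ hδ1 hr u p hsol hSob hnear
  obtain ⟨B, hB0, hfar⟩ := hF ν T t₀ r u p hν ht₀ hT hr hsol hSob
  have hcc : 0 < (1 + c) / 2 - c := by linarith
  refine hA0 ν T t₀ (max l₀ (Real.sqrt (B / ((1 + c) / 2 - c)))) ((1 + c) / 2) δ hν ht₀ hT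
    (le_max_of_le_left hl₀) (by linarith) hδ hδ1 u p hsol hSob ?_
  intro t ht x e hax hq1
  have he : ‖e‖ = 1 := hax.1
  have ht' : t ∈ Ico 0 T := ⟨ht₀.trans ht.1, ht.2⟩
  have hq0 : l₀ < strainQuad u t x e := lt_of_le_of_lt (le_max_left _ _) hq1
  have hsq : Real.sqrt (B / ((1 + c) / 2 - c)) < strainQuad u t x e := lt_of_le_of_lt (le_max_right _ _) hq1
  have hqpos : 0 < strainQuad u t x e := lt_of_le_of_lt (Real.sqrt_nonneg _) hsq
  have hB : B / ((1 + c) / 2 - c) < strainQuad u t x e ^ 2 := (Real.sqrt_lt' hqpos).1 hsq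
  have hB' : B < ((1 + c) / 2 - c) * strainQuad u t x e ^ 2 := by
    rw [div_lt_iff₀ hcc] at hB; linarith
  have hn := hnear t ht x e hax hq0
  have hsplit := hSp ν T u p hν hsol hSob t ht' r hr x e he
  have hfb := hfar t ht x e he
  have hpi : 0 < 1 / (4 * π) := by positivity
  have h1 : (1 / (4 * π)) * farQuadS r u t x e ≤ B :=
    le_trans (mul_le_mul_of_nonneg_left (le_abs_self _) hpi.le) hfb
  rw [hsplit]
  linarith

/-- ★ **D7♭ CLOSED modulo the two TRUE plates**: door A0 is held BY NAME (`strainRatioDoor_holds`, S40 P0-40 Closers). -/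
theorem nearFieldSubParityDoor_of_plates (hSp : PressureHessianSplitsSmooth) (hF : FarFieldUniformBound) :
    NearFieldSubParityDoor :=
  nearFieldSubParityDoor_of hSp hF strainRatioDoor_holds

/-- Π ← A1 (local algebra). -/
theorem pressureHessianSplits_of (h : NewtonHessianFormula) : PressureHessianSplits := by
  intro ν T u p hν hsol hSob t ht r hr x e he
  have hp := h ν T u p hν hsol hSob t ht r hr x e he
  unfold strainFeed nearFeed localFeed
  unfold qDensity at hp
  rw [hp]; ring

/-- Π♭ ← A1♭. -/
theorem pressureHessianSplitsSmooth_of (h : NewtonHessianFormulaSmooth) : PressureHessianSplitsSmooth := by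
  intro ν T u p hν hsol hSob t ht r hr x e he
  have hp := h ν T u p hν hsol hSob t ht r hr x e he
  unfold strainFeed nearFeedS localFeed
  unfold qDensity at hp
  rw [hp]; ring

/-- F ← A2 ∧ A3: `b(t) = ‖∇u(t)‖₂²/(2πr³)`, `Φ_F = Φ/(2πr³)`, `β = E(u(t₀))/(2πνr³)`. -/
theorem farFieldBudget_of (h2 : FarFieldL1Bound) (h3 : DissipationPrimitive) : FarFieldBudget := by
  intro ν T t₀ r u p hν ht₀ hT hr hsol hSob
  obtain ⟨Φ, hΦ0, hΦ⟩ := h3 ν T t₀ u p hν ht₀ hT hsol hSob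
  have h2π : 0 < 2 * π * r ^ 3 := by positivity
  refine ⟨VectorCalculus.kineticEnergy (u t₀) / ν / (2 * π * r ^ 3), fun t => Φ t / (2 * π * r ^ 3),
    fun t => VectorCalculus.gradNormSq (u t) / (2 * π * r ^ 3), by simp [hΦ0], ?_, ?_⟩
  · intro t ht
    obtain ⟨h0, hE, hd⟩ := hΦ t ht
    exact ⟨div_nonneg h0 h2π.le, div_le_div_of_nonneg_right hE h2π.le, hd.div_const _⟩
  · intro t ht x e he
    have ht' : t ∈ Ico 0 T := ⟨ht₀.trans ht.1, ht.2⟩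
    have hb := h2 ν T u p hν hsol hSob t ht' r hr x e he
    have hpi : 0 < 1 / (4 * π) := by positivity
    calc 1 / (4 * π) * |farQuad r u t x e| ≤ 1 / (4 * π) * (2 / r ^ 3 * VectorCalculus.gradNormSq (u t)) :=
          mul_le_mul_of_nonneg_left hb hpi.le
      _ = VectorCalculus.gradNormSq (u t) / (2 * π * r ^ 3) := by
          field_simp
          ring

/-- F♭ ← A2♭ ∧ A3′: `B = C·E(u(t₀))/(4π r⁵)`. -/
theorem farFieldUniformBound_of (h2 : FarFieldEnergyBound) (h3 : EnergyNonIncreasing) : FarFieldUniformBound := by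
  intro ν T t₀ r u p hν ht₀ hT hr hsol hSob
  obtain ⟨C, hC0, hC⟩ := h2
  refine ⟨1 / (4 * π) * (C / r ^ 5 * VectorCalculus.kineticEnergy (u t₀)), by
    have := kineticEnergy_nonneg (u t₀); positivity, ?_⟩
  intro t ht x e he
  have ht' : t ∈ Ico 0 T := ⟨ht₀.trans ht.1, ht.2⟩
  have hb := hC ν T u p hν hsol hSob t ht' r hr x e he
  have hE := h3 ν T u p hν hsol hSob t₀ t ht₀ ht.1 ht.2
  have hpi : 0 < 1 / (4 * π) := by positivity
  have hCr : 0 ≤ C / r ^ 5 := by positivity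
  calc 1 / (4 * π) * |farQuadS r u t x e| ≤ 1 / (4 * π) * (C / r ^ 5 * VectorCalculus.kineticEnergy (u t)) :=
        mul_le_mul_of_nonneg_left hb hpi.le
    _ ≤ 1 / (4 * π) * (C / r ^ 5 * VectorCalculus.kineticEnergy (u t₀)) :=
        mul_le_mul_of_nonneg_left (mul_le_mul_of_nonneg_left hE hCr) hpi.le

/-- A2's pointwise algebra atom: `|f| ≤ |∇u|²_F` (from `|ω|² ≤ 2|∇u|²_F`, tree `norm_curl_sq_le_two_mul_frobeniusNormSq`). -/
theorem abs_qDensity_le (u : ℝ → (EuclideanSpace ℝ (Fin 3)) → (EuclideanSpace ℝ (Fin 3))) (t : ℝ) (x : EuclideanSpace ℝ (Fin 3)) :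
    |qDensity u t x| ≤ frobeniusNormSq (fderiv ℝ (u t) x) := by
  have h2 := norm_curl_sq_le_two_mul_frobeniusNormSq (u t) x
  have h0 : 0 ≤ ‖curl (u t) x‖ ^ 2 := sq_nonneg _
  unfold qDensity strainNormSq
  rw [abs_le]; constructor <;> linarith

/-- A2's pointwise far-integrand bound: for `‖y‖ ≥ r > 0`, `|K_e(y)·f(x+y)| ≤ (2/r³)·|∇u(x+y)|²_F`
(so A2 = this + `integral_mono` + translation invariance of `gradNormSq`). -/
theorem abs_farIntegrand_le {r : ℝ} (hr : 0 < r) (u : ℝ → (EuclideanSpace ℝ (Fin 3)) → (EuclideanSpace ℝ (Fin 3))) (t : ℝ)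
    (x : EuclideanSpace ℝ (Fin 3)) {e y : EuclideanSpace ℝ (Fin 3)} (he : ‖e‖ = 1) (hy : r ≤ ‖y‖) :
    |quadKernel e y * qDensity u t (x + y)| ≤ 2 / r ^ 3 * frobeniusNormSq (fderiv ℝ (u t) (x + y)) := by
  rw [abs_mul]
  exact mul_le_mul (abs_quadKernel_le_of_le he hr hy) (abs_qDensity_le u t (x + y)) (abs_nonneg _) (by positivity)

/-- ★ the whole ledger: D7 from the three atoms A1, A2, A3 (D5 by name). -/
theorem nearFieldParityDoor_of_atoms (h1 : NewtonHessianFormula) (h2 : FarFieldL1Bound) (h3 : DissipationPrimitive) :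
    NearFieldParityDoor :=
  nearFieldParityDoor_of_plates (pressureHessianSplits_of h1) (farFieldBudget_of h2 h3)

/-- ★ the whole ledger: D7♭ from the three atoms A1♭, A2♭, A3′ (A0 by name). -/
theorem nearFieldSubParityDoor_of_atoms (h1 : NewtonHessianFormulaSmooth) (h2 : FarFieldEnergyBound)
    (h3 : EnergyNonIncreasing) : NearFieldSubParityDoor :=
  nearFieldSubParityDoor_of_plates (pressureHessianSplitsSmooth_of h1) (farFieldUniformBound_of h2 h3)

/-- continuity of `x ↦ |∇v(x)|²_F` for a `C¹` field. -/
theorem continuous_frobeniusNormSq_fderiv_of_contDiff {v : (EuclideanSpace ℝ (Fin 3)) → (EuclideanSpace ℝ (Fin 3))}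
    (hv : ContDiff ℝ 1 v) : Continuous fun x => frobeniusNormSq (fderiv ℝ v x) := by
  unfold frobeniusNormSq
  exact continuous_finsetSum _ fun i _ =>
    (((hv.continuous_fderiv one_ne_zero).clm_apply continuous_const).norm).pow 2

/-- in the door frame `x ↦ |∇u(t,x)|²_F` is integrable at every `t ∈ [0,T)` (Sobolev bound `n = 1` + `|L|²_F ≤ 3‖L‖²`). -/
theorem integrable_frobeniusNormSq_fderiv_of_frame {ν T : ℝ}
    {u : ℝ → (EuclideanSpace ℝ (Fin 3)) → (EuclideanSpace ℝ (Fin 3))} {p : ℝ → (EuclideanSpace ℝ (Fin 3)) → ℝ}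
    (hsol : IsClassicalNSSolutionOn (Ico 0 T) ν 0 u p) (hSob : ∀ T'' < T, HasBoundedSobolevNormsOn (Icc 0 T'') u)
    {t : ℝ} (ht : t ∈ Ico 0 T) : Integrable (fun z => frobeniusNormSq (fderiv ℝ (u t) z)) := by
  have hsm : ContDiff ℝ 1 (u t) := (hsol.contDiff_velocity ht).of_le (by exact_mod_cast le_top)
  have hc := continuous_frobeniusNormSq_fderiv_of_contDiff hsm
  obtain ⟨C, hC⟩ := hSob t ht.2 1
  have hfin : ∫⁻ z, ‖frobeniusNormSq (fderiv ℝ (u t) z)‖ₑ < ⊤ := by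
    have h1 : ∫⁻ z, ‖frobeniusNormSq (fderiv ℝ (u t) z)‖ₑ ≤ 3 * ∫⁻ z, ‖iteratedFDeriv ℝ 1 (u t) z‖ₑ ^ 2 := by
      rw [← lintegral_const_mul' _ _ (by norm_num)]
      refine lintegral_mono fun z => ?_
      rw [Real.enorm_eq_ofReal (frobeniusNormSq_nonneg _), enorm_iteratedFDeriv_one]
      exact ofReal_frobeniusNormSq_le_three_mul_enorm_sq _
    refine lt_of_le_of_lt h1 ?_
    exact ENNReal.mul_lt_top (by norm_num) (lt_of_le_of_lt (hC t ⟨ht.1, le_rfl⟩) ENNReal.coe_lt_top)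
  exact ⟨hc.aestronglyMeasurable, hfin⟩

/-- ★ atom A2 PROVED: `|farQuad_r| ≤ (2/r³)·‖∇u(t)‖₂²` (kernel bound + `|f| ≤ |∇u|²_F` + `integral_mono` + translation invariance). -/
theorem farFieldL1Bound_holds : FarFieldL1Bound := by
  intro ν T u p hν hsol hSob t ht r hr x e he
  have hInt := integrable_frobeniusNormSq_fderiv_of_frame hsol hSob ht
  have hIntx : Integrable (fun y => frobeniusNormSq (fderiv ℝ (u t) (x + y))) := hInt.comp_add_left x
  have hr3 : 0 ≤ 2 / r ^ 3 := by positivity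
  have hgi : Integrable (fun y => 2 / r ^ 3 * frobeniusNormSq (fderiv ℝ (u t) (x + y))) := hIntx.const_mul _
  have h1 : |farQuad r u t x e| ≤ ∫ y in (ball (0 : EuclideanSpace ℝ (Fin 3)) r)ᶜ, |quadKernel e y * qDensity u t (x + y)| := by
    unfold farQuad
    have h := norm_integral_le_integral_norm (μ := volume.restrict (ball (0 : EuclideanSpace ℝ (Fin 3)) r)ᶜ)
      (fun y => quadKernel e y * qDensity u t (x + y))
    simpa only [Real.norm_eq_abs] using h
  have h2 : ∫ y in (ball (0 : EuclideanSpace ℝ (Fin 3)) r)ᶜ, |quadKernel e y * qDensity u t (x + y)| ≤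
      ∫ y in (ball (0 : EuclideanSpace ℝ (Fin 3)) r)ᶜ, 2 / r ^ 3 * frobeniusNormSq (fderiv ℝ (u t) (x + y)) := by
    refine integral_mono_of_nonneg (Eventually.of_forall fun y => abs_nonneg _) hgi.integrableOn ?_
    rw [EventuallyLE, ae_restrict_iff' measurableSet_ball.compl]
    refine Eventually.of_forall fun y hy => ?_
    have hy' : r ≤ ‖y‖ := by simpa [mem_ball, dist_zero_right, not_lt] using hy
    exact abs_farIntegrand_le hr u t x he hy'
  have h3 : ∫ y in (ball (0 : EuclideanSpace ℝ (Fin 3)) r)ᶜ, 2 / r ^ 3 * frobeniusNormSq (fderiv ℝ (u t) (x + y)) ≤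
      ∫ y, 2 / r ^ 3 * frobeniusNormSq (fderiv ℝ (u t) (x + y)) :=
    setIntegral_le_integral hgi (Eventually.of_forall fun y => mul_nonneg hr3 (frobeniusNormSq_nonneg _))
  have h4 : ∫ y, 2 / r ^ 3 * frobeniusNormSq (fderiv ℝ (u t) (x + y)) = 2 / r ^ 3 * VectorCalculus.gradNormSq (u t) := by
    rw [integral_const_mul, integral_add_left_eq_self (fun z => frobeniusNormSq (fderiv ℝ (u t) z)) x]
    rfl
  linarith [h1, h2, h3, h4.le]

/-- plate F from A3 alone (A2 proved). -/
theorem farFieldBudget_of_dissipationPrimitive (h3 : DissipationPrimitive) : FarFieldBudget :=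
  farFieldBudget_of farFieldL1Bound_holds h3

/-- ★ D7 from A1 and A3 only. -/
theorem nearFieldParityDoor_of_A1_A3 (h1 : NewtonHessianFormula) (h3 : DissipationPrimitive) : NearFieldParityDoor :=
  nearFieldParityDoor_of_atoms h1 farFieldL1Bound_holds h3

end Summit.NavierStokesRegularity.NavierStokesRegularity.Theorems.StrainDoors
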